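import Summits.BirchSwinnertonDyer.BirchSwinnertonDyer.Theorems.SignedLowerHalvesKobayashiLowerHalfSemistableDefmuThetaNormRelationSS
import Summits.BirchSwinnertonDyer.BirchSwinnertonDyer.Theorems.SignedLowerHalvesKobayashiLowerHalfSemistableDefmuTorsionImageTower
import HarnessLib

/-!
# Darmon–Iovita (8) for the anticyclotomic elements `L_n ∈ ℤ_p[G̃_{n+1}/Δ]` and the PARITY PROPAGATION of `μ = 0`:
# Pollack–Weston 2011 Thm. 2.5 (i) ("`μ(L_n) = 0` for `n ≫ 0`", tree `HasMuZeroLAc`) ⟺ one even AND one odd witness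

Route-independent `Theorems` file (cell `b2b-bsdres`, seat `b2b-bsdres-x10b` = class owner X6/X7, gen 43); part 3 of the
series «defmu / supersingular theta elements» serving crux 2 `KobayashiLowerHalfSemistable` (stmt-BirchSwinnertonDyer-19000,
line «defmu»: cite stub `stub_publishedInputs`, conjunct `pollackWeston2011_thm_2_5_hasMuZeroLAc` = v4's `stub_acMuInput`).
HONEST FRAMING: prove what is provable now; shrink each hard class to its core with data; no claim beyond stated classes.
Nothing about any curve is asserted and NO summit statement is proved here; BSD is not proved by any of this. The named fact
`pollackWeston2011_thm_2_5_hasMuZeroLAc` (Vatsal-type `μ = 0`, CLASS-WIDE over all `K` and all towers) is NOT discharged; what is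
proved is its STRUCTURE: per instance `(K, S, p, E, φ, tower)` it is equivalent to a FINITE check at two layers.

* §1 group-ring bookkeeping: coefficients of `mapDomain` are fibre sums; a sum of coefficients over a union of fibres of `f` is a
  sum of coefficients of `mapDomain f` (`sum_filter_comp_coeff_eq`), hence inherits divisibility.
* §2 `Δ`-cosets: the fibre of `acProj` through `ρ₀` is `ρ₀ · torsionImage` (`sum_filter_acProj_eq`); `acProj ∘ picRes` factors
  through `acProj` (`acProj_picRes_eq_of_acProj_eq`, from part 2a's `picRes_mem_torsionImage`).
* §3 **Darmon–Iovita 2008 (8), `π_{n+1,n}(L_{n+1}) = a_p L_n − ξ_n L_{n−1}`, coefficientwise** (`sum_fibre_y_eq`): for `k ≥ 0` and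
  `ρ ∈ G̃_{k+2}`, `Σ_{τ ∈ G̃_{k+3}, τ̄ ∈ ρΔ} y_{k+3}(τ) = a · Σ_{δ ∈ Δ_{k+2}} y_{k+2}(ρδ) − Σ_{δ' ∈ Δ_{k+1}} y_{k+1}(ρ̄ δ')` — the norm
  relation of part 1 summed over a `Δ`-coset, the last sum transported along the BIJECTION `Δ_{k+2} ≃ Δ_{k+1}` of part 2b
  (`sum_torsionImage_comp_picRes`; this is where `Δ ↪ G̃_{k+1}` — `p` odd, levels `≥ 1` — is used, exactly as in DI's
  "`G_n := G̃_{n+1}/Δ`").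
* §4 **propagation at `p ∣ a` (supersingular: `a = a_p(E) = 0`)**: `p ∣ L_{k+2} ⇒ p ∣ L_k` coefficientwise
  (`dvd_coeff_lAc_of_dvd_coeff_lAc_add_two`); so a unit coefficient of `L_k` gives one of `L_{k+2j}`
  (`exists_isUnit_coeff_lAc_add_two_mul`): **`μ(L_k) = 0 ⇒ μ(L_{k+2j}) = 0`**.
* §5 **`HasMuZeroLAc ↔ (∃ even n, μ(L_n) = 0) ∧ (∃ odd n, μ(L_n) = 0)`** (`hasMuZeroLAc_iff_even_odd`); in particular the two
  layers `n = 0, 1` suffice (`hasMuZeroLAc_of_isUnit_coeff_zero_one`), and in the exact hypothesis shape of the named fact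
  (`hasMuZeroLAc_of_first_two_layers`: `a_p(E) = 0`, `φ` a generator of the eigen-line): PW Thm. 2.5 (i) FOR A GIVEN TOWER
  follows from two unit coefficients of the Darmon–Iovita elements `L_0 ∈ ℤ_p[Pic(𝒪_p)/Δ]`, `L_1 ∈ ℤ_p[Pic(𝒪_{p²})/Δ]` — finitely
  many Gross points of conductor `p` and `p²`, a finite Brandt-module computation (per-instance DECIDABLE certificate shape;
  the class-wide statement remains Vatsal's theorem / PW's "generalize immediately").

## References

* [DarmonIovita2008] H. Darmon, A. Iovita, J. Inst. Math. Jussieu 7 (2008), §2.2: Lemma 2.6, `L_n := ν(L̃_{n+1})`, (8)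
  "`π_{n+1,n}(L_{n+1}) = −ξ_n L_{n−1}` for all `n ≥ 1`", Lemma 2.7, Prop. 2.8.
* [PollackWeston2011] R. Pollack, T. Weston, Compos. Math. 147 (2011), §2.3 (`μ`), §2.4 Thm. 2.5 and its proof ("`μ(L_n) = 0`
  for `n` large enough").
* [BertoliniDarmon2005] M. Bertolini, H. Darmon, Ann. of Math. 162 (2005), §1.2 (`Δ`, `G_∞ = G̃_∞/Δ`).
-/

noncomputable section

open scoped BigOperators Matrix

-- D-0017: single-problem summit, the namespace repeats the problem name by design.
set_option linter.dupNamespace false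

namespace Summit.BirchSwinnertonDyer.BirchSwinnertonDyer.Theorems.DefmuSupersingularTheta

open Literature.NumberTheory.EllipticCurves Literature.NumberTheory.EllipticCurves.QuadOrderTower
  Literature.NumberTheory.EllipticCurves.GrossPointTowerNorm Literature.NumberTheory.Automorphic
  Literature.NumberTheory.QuadraticFields.Quadratic NumberField

universe u

variable {K : Type u} [Field K] [NumberField K] (p : ℕ) [hp : Fact p.Prime]
  {Nplus Nminus : ℕ} {S : Brandt.XiSetup Nplus Nminus}

/-! ### §1 Group-ring bookkeeping: coefficients of `mapDomain` and sums over unions of fibres -/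

omit [NumberField K] in
/-- **Coefficients of `mapDomain f`** are the fibre sums: `(f_* x)(h) = Σ_{f σ = h} x(σ)`. [folklore] -/
theorem coeff_mapDomainRingHom_eq_sum {G H : Type*} [CommGroup G] [CommGroup H] [Fintype G] [DecidableEq H]
    (f : G →* H) (x : MonoidAlgebra ℤ_[p] G) (h : H) :
    (MonoidAlgebra.mapDomainRingHom ℤ_[p] f x).coeff h = ∑ σ ∈ Finset.univ.filter (fun σ => f σ = h), x.coeff σ := by
  classical
  rw [MonoidAlgebra.mapDomainRingHom_apply, MonoidAlgebra.mapDomain, MonoidAlgebra.coeff_ofCoeff, Finsupp.mapDomain,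
    Finsupp.sum_fintype _ _ (fun _ => Finsupp.single_zero _), Finsupp.finsetSum_apply, Finset.sum_filter]
  refine Finset.sum_congr rfl fun σ _ => ?_
  rw [Finsupp.single_apply]

omit [NumberField K] in
/-- **A sum of coefficients of `x` over a union of fibres of `f` is a sum of coefficients of `f_* x`.** [folklore] -/
theorem sum_filter_comp_coeff_eq {G H : Type*} [CommGroup G] [CommGroup H] [Fintype G] [Fintype H] [DecidableEq H]
    (f : G →* H) (x : MonoidAlgebra ℤ_[p] G) (P : H → Prop) [DecidablePred P] :
    ∑ τ ∈ Finset.univ.filter (fun τ => P (f τ)), x.coeff τ =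
      ∑ q ∈ Finset.univ.filter P, (MonoidAlgebra.mapDomainRingHom ℤ_[p] f x).coeff q := by
  simp_rw [coeff_mapDomainRingHom_eq_sum]
  rw [Finset.sum_fiberwise_eq_sum_filter]
  refine Finset.sum_congr ?_ fun _ _ => rfl
  ext τ
  simp

omit [NumberField K] in
/-- So if every coefficient of `f_* x` is divisible by `d`, every such fibre-union sum of coefficients of `x` is. [folklore] -/
theorem dvd_sum_filter_comp_coeff {G H : Type*} [CommGroup G] [CommGroup H] [Fintype G] [Fintype H] [DecidableEq H]
    (f : G →* H) (x : MonoidAlgebra ℤ_[p] G) (d : ℤ_[p])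
    (hdvd : ∀ q, d ∣ (MonoidAlgebra.mapDomainRingHom ℤ_[p] f x).coeff q) (P : H → Prop) [DecidablePred P] :
    d ∣ ∑ τ ∈ Finset.univ.filter (fun τ => P (f τ)), x.coeff τ := by
  rw [sum_filter_comp_coeff_eq]
  exact Finset.dvd_sum fun q _ => hdvd q

/-! ### §2 `Δ`-cosets: fibres of `acProj`, and `acProj ∘ picRes` factors through `acProj` -/

omit [NumberField K] hp in
/-- **The fibre of `G̃_n → G̃_n/Δ` through `ρ₀` is the coset `ρ₀Δ`**: `Σ_{[σ] = [ρ₀]} F(σ) = Σ_{δ ∈ Δ} F(ρ₀δ)`. [folklore] -/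
theorem sum_filter_acProj_eq (n : ℕ) [Fintype (ClassGroup (quadOrder K (p ^ n)))]
    [DecidableEq (AcLayerGroup K p n)] [DecidablePred (· ∈ torsionImage K p n)]
    {M : Type*} [AddCommMonoid M] (ρ₀ : ClassGroup (quadOrder K (p ^ n))) (F : ClassGroup (quadOrder K (p ^ n)) → M) :
    ∑ σ ∈ Finset.univ.filter (fun σ => acProj K p n σ = acProj K p n ρ₀), F σ =
      ∑ δ ∈ Finset.univ.filter (· ∈ torsionImage K p n), F (ρ₀ * δ) := by
  symm
  refine Finset.sum_nbij' (fun δ => ρ₀ * δ) (fun σ => ρ₀⁻¹ * σ) (fun δ hδ => ?_) (fun σ hσ => ?_)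
    (fun δ _ => inv_mul_cancel_left ρ₀ δ) (fun σ _ => mul_inv_cancel_left ρ₀ σ) (fun _ _ => rfl)
  · simp only [Finset.mem_filter, Finset.mem_univ, true_and] at hδ ⊢
    rw [QuotientGroup.mk'_apply, QuotientGroup.mk'_apply, QuotientGroup.eq, mul_inv_rev, inv_mul_cancel_right]
    exact Subgroup.inv_mem _ hδ
  · simp only [Finset.mem_filter, Finset.mem_univ, true_and] at hσ ⊢
    rw [QuotientGroup.mk'_apply, QuotientGroup.mk'_apply, QuotientGroup.eq] at hσ
    simpa using Subgroup.inv_mem _ hσ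

/-- **`acProj ∘ picRes` factors through `acProj`** (the restrictions map `Δ` into `Δ`, part 2a): classes with the same image in
`G̃_m/Δ` restrict to classes with the same image in `G̃_n/Δ`. [cite: BertoliniDarmon2005, §1.2 (21)] -/
theorem acProj_picRes_eq_of_acProj_eq {n m : ℕ} (hnm : n ≤ m) {τ₁ τ₂ : ClassGroup (quadOrder K (p ^ m))}
    (h : acProj K p m τ₁ = acProj K p m τ₂) :
    acProj K p n (picRes K (pow_dvd_pow p hnm) τ₁) = acProj K p n (picRes K (pow_dvd_pow p hnm) τ₂) := by
  rw [QuotientGroup.mk'_apply, QuotientGroup.mk'_apply, QuotientGroup.eq] at h ⊢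
  rw [← map_inv, ← map_mul]
  exact picRes_mem_torsionImage p hnm h

/-! ### §3 Darmon–Iovita (8), coefficientwise: the norm relation summed over a `Δ`-coset -/

/-- **Darmon–Iovita 2008, (8) — `π_{n+1,n}(L_{n+1}) = a·L_n − ξ_n L_{n−1}` — in coefficients** (`K` imaginary quadratic, `p` odd,
`p ∤ N⁺N⁻`, `T(p)φ = aφ`): for `k ≥ 0` and `ρ ∈ G̃_{k+2} = Pic(𝒪_{p^{k+2}})`,
`Σ_{τ ∈ G̃_{k+3}, [τ̄] = [ρ]} y_{k+3}(τ) = a · Σ_{δ ∈ Δ_{k+2}} y_{k+2}(ρδ) − Σ_{δ' ∈ Δ_{k+1}} y_{k+1}(ρ̄ δ')`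
(`Δ_m = torsionImage (m)`, `[·]` the class mod `Δ`, `y_m(σ) = ⟨σ x_m, φ⟩`). The left side is the sum of the coefficients of
`L_{k+2}` over the fibre of `[ρ]`, the two sums on the right are the `[ρ]`- and `[ρ̄]`-coefficients of `L_{k+1}`, `L_k` (up to
the involution `σ ↦ σ⁻¹` of the tree's convention `L̃_n = Σ y_n(σ) σ⁻¹`). Proof: Lemma 2.6 (`GrossPointTowerNorm.norm_relation`)
on each fibre `τ̄ = ρδ`, `δ ∈ Δ_{k+2}`, and the bijection `Δ_{k+2} ≃ Δ_{k+1}` (`sum_torsionImage_comp_picRes`).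
[cite: DarmonIovita2008, §2.2 Lemma 2.6 and (8)] [cite: BertoliniDarmon1996, §2.4 (5)] -/
theorem sum_fibre_y_eq [Fintype (Brandt.ClassSet S.O)] (hK : IsImaginaryQuadratic K) (hp2 : p ≠ 2)
    (hpN : ¬ p ∣ Nplus * Nminus) (φ : Brandt.ClassSet S.O → ℤ) (a : ℤ)
    (hφ : Brandt.matrix S.O p *ᵥ φ = a • φ) (T : GrossPointTower K S p) (k : ℕ)
    [Fintype (ClassGroup (quadOrder K (p ^ (k + 3))))] [Fintype (ClassGroup (quadOrder K (p ^ (k + 2))))]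
    [Fintype (ClassGroup (quadOrder K (p ^ (k + 1))))] [DecidableEq (AcLayerGroup K p (k + 2))]
    [DecidablePred (· ∈ torsionImage K p (k + 2))] [DecidablePred (· ∈ torsionImage K p (k + 1))]
    (ρ : ClassGroup (quadOrder K (p ^ (k + 2)))) :
    ∑ τ ∈ Finset.univ.filter (fun τ => acProj K p (k + 2) (picRes K (pow_dvd_pow p (k + 2).le_succ) τ) =
        acProj K p (k + 2) ρ), T.y p φ (k + 3) τ =
      a * ∑ δ ∈ Finset.univ.filter (· ∈ torsionImage K p (k + 2)), T.y p φ (k + 2) (ρ * δ) -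
        ∑ δ' ∈ Finset.univ.filter (· ∈ torsionImage K p (k + 1)),
          T.y p φ (k + 1) (picRes K (pow_dvd_pow p (k + 1).le_succ) ρ * δ') := by
  classical
  obtain ⟨b, hb⟩ := exists_basis_zero_eq_one (K := K) hK.1
  have hc : p ^ (k + 2) = p ^ (k + 1) * p := pow_succ p (k + 1)
  have hd : p ^ (k + 3) = p ^ (k + 2) * p := pow_succ p (k + 2)
  have hpc : p ∣ p ^ (k + 2) := dvd_pow_self p (by omega)
  -- regroup the left side along the values `σ = τ̄ ∈ ρΔ`
  have step1 : ∑ τ ∈ Finset.univ.filter (fun τ => acProj K p (k + 2) (picRes K (pow_dvd_pow p (k + 2).le_succ) τ) =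
        acProj K p (k + 2) ρ), T.y p φ (k + 3) τ =
      ∑ σ ∈ Finset.univ.filter (fun σ => acProj K p (k + 2) σ = acProj K p (k + 2) ρ),
        ∑ τ ∈ Finset.univ.filter (fun τ => picRes K (pow_dvd_pow p (k + 2).le_succ) τ = σ), T.y p φ (k + 3) τ := by
    have h1 : ∑ τ ∈ Finset.univ.filter (fun τ => acProj K p (k + 2) (picRes K (pow_dvd_pow p (k + 2).le_succ) τ) =
        acProj K p (k + 2) ρ), T.y p φ (k + 3) τ =
        ∑ τ ∈ Finset.univ.filter (fun τ => picRes K (pow_dvd_pow p (k + 2).le_succ) τ ∈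
          Finset.univ.filter (fun σ => acProj K p (k + 2) σ = acProj K p (k + 2) ρ)), T.y p φ (k + 3) τ := by
      refine Finset.sum_congr ?_ fun _ _ => rfl
      ext τ
      simp
    rw [h1]
    exact (Finset.sum_fiberwise_eq_sum_filter _ _ _ _).symm
  rw [step1, sum_filter_acProj_eq p (k + 2) ρ]
  -- each fibre sum by the norm relation (Lemma 2.6)
  have step2 : ∀ δ : ClassGroup (quadOrder K (p ^ (k + 2))),
      ∑ τ ∈ Finset.univ.filter (fun τ => picRes K (pow_dvd_pow p (k + 2).le_succ) τ = ρ * δ), T.y p φ (k + 3) τ =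
        a * T.y p φ (k + 2) (ρ * δ) -
          T.y p φ (k + 1) (picRes K (pow_dvd_pow p (k + 1).le_succ) (ρ * δ)) := fun δ => by
    obtain ⟨σ₀, hσ₀⟩ := picRes_surjective (K := K) hK.1 hpc hd (ρ * δ)
    have hNR := norm_relation hb hK HeegnerStable_holds hpN hpc hc hd φ a hφ (T.mem_grossPoints (k + 3))
      (T.mem_grossPoints (k + 2)) (T.mem_grossPoints (k + 1)) (T.isPNeighbour (k + 2)) (T.isPNeighbour (k + 1)) σ₀
    rw [hσ₀] at hNR
    simp only [GrossPointTower.y]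
    exact hNR
  rw [Finset.sum_congr rfl fun δ _ => step2 δ, Finset.sum_sub_distrib, ← Finset.mul_sum]
  congr 1
  simp_rw [map_mul]
  exact sum_torsionImage_comp_picRes p hK hp2 k
    (fun δ' => T.y p φ (k + 1) (picRes K (pow_dvd_pow p (k + 1).le_succ) ρ * δ'))

/-! ### §4 Propagation at `p ∣ a`: `p ∣ L_{k+2} ⇒ p ∣ L_k`; a unit coefficient of `L_k` gives one of `L_{k+2j}` -/

/-- **The coefficients of `L_k` are `Δ`-coset sums**: for `[ρ₀] = q⁻¹` in `G̃_{k+1}/Δ`,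
`L_k(q) = Σ_{δ' ∈ Δ_{k+1}} y_{k+1}(ρ₀δ')` (the tree's `L̃_n = Σ y_n(σ) σ⁻¹`, `L_n = ν(L̃_{n+1})`).
[cite: DarmonIovita2008, §2.2 (definition of L_n)] -/
theorem coeff_lAc_eq_sum_torsionImage (φ : Brandt.ClassSet S.O → ℤ) (T : GrossPointTower K S p) (k : ℕ)
    [Fintype (ClassGroup (quadOrder K (p ^ (k + 1))))] [DecidableEq (AcLayerGroup K p (k + 1))]
    [DecidablePred (· ∈ torsionImage K p (k + 1))]
    (q : AcLayerGroup K p (k + 1)) (ρ₀ : ClassGroup (quadOrder K (p ^ (k + 1))))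
    (hρ₀ : acProj K p (k + 1) ρ₀ = q⁻¹) :
    (T.lAc p φ k).coeff q =
      ∑ δ' ∈ Finset.univ.filter (· ∈ torsionImage K p (k + 1)), ((T.y p φ (k + 1) (ρ₀ * δ') : ℤ) : ℤ_[p]) := by
  rw [GrossPointTower.lAc, coeff_mapDomainRingHom_eq_sum]
  simp only [GrossPointTower.coeff_lTilde]
  have e2 : ∑ σ ∈ Finset.univ.filter (fun σ => acProj K p (k + 1) σ = q), ((T.y p φ (k + 1) σ⁻¹ : ℤ) : ℤ_[p]) =
      ∑ σ ∈ Finset.univ.filter (fun σ => acProj K p (k + 1) σ = acProj K p (k + 1) ρ₀),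
        ((T.y p φ (k + 1) σ : ℤ) : ℤ_[p]) := by
    refine Finset.sum_nbij' (fun σ => σ⁻¹) (fun σ => σ⁻¹) (fun σ hσ => ?_) (fun σ hσ => ?_)
      (fun σ _ => inv_inv σ) (fun σ _ => inv_inv σ) (fun _ _ => rfl)
    · simp only [Finset.mem_filter, Finset.mem_univ, true_and] at hσ ⊢
      rw [map_inv, hσ, hρ₀]
    · simp only [Finset.mem_filter, Finset.mem_univ, true_and] at hσ ⊢
      rw [map_inv, hσ, hρ₀, inv_inv]
  rw [e2, sum_filter_acProj_eq]

/-- **The `Δ`-fibre-union sums of `y_{k+3}` inherit divisibility from `L_{k+2}`**: if `d` divides every coefficient of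
`L_{k+2} = ν(L̃_{k+3})`, then `d ∣ Σ_{τ : [τ̄] = [ρ]} y_{k+3}(τ)` (the left side of (8)); indeed that sum is a sum of
coefficients of `L_{k+2}` over the classes `q'` with `π(q'⁻¹) = [ρ]`, `π : G̃_{k+3}/Δ → G̃_{k+2}/Δ` the induced map
(`QuotientGroup.map`, well defined by part 2a). [cite: DarmonIovita2008, §2.2 (8)] -/
theorem dvd_sum_fibre_y_of_dvd_coeff_lAc (φ : Brandt.ClassSet S.O → ℤ) (T : GrossPointTower K S p) (k : ℕ)
    [Fintype (ClassGroup (quadOrder K (p ^ (k + 3))))] [DecidableEq (AcLayerGroup K p (k + 2))]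
    (ρ : ClassGroup (quadOrder K (p ^ (k + 2)))) (d : ℤ_[p])
    (h : ∀ q, d ∣ (T.lAc p φ (k + 2)).coeff q) :
    d ∣ ∑ τ ∈ Finset.univ.filter (fun τ => acProj K p (k + 2) (picRes K (pow_dvd_pow p (k + 2).le_succ) τ) =
        acProj K p (k + 2) ρ), ((T.y p φ (k + 3) τ : ℤ) : ℤ_[p]) := by
  classical
  have hle : torsionImage K p (k + 3) ≤
      (torsionImage K p (k + 2)).comap (picRes K (pow_dvd_pow p (k + 2).le_succ)) := by
    intro g hg
    rw [Subgroup.mem_comap]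
    exact picRes_mem_torsionImage p (k + 2).le_succ hg
  have hmap : ∀ τ : ClassGroup (quadOrder K (p ^ (k + 3))),
      acProj K p (k + 2) (picRes K (pow_dvd_pow p (k + 2).le_succ) τ) =
        QuotientGroup.map (torsionImage K p (k + 3)) (torsionImage K p (k + 2))
          (picRes K (pow_dvd_pow p (k + 2).le_succ)) hle (acProj K p (k + 3) τ) := fun τ => by
    rw [QuotientGroup.mk'_apply, QuotientGroup.mk'_apply, QuotientGroup.map_mk]
  set πac := QuotientGroup.map (torsionImage K p (k + 3)) (torsionImage K p (k + 2))
    (picRes K (pow_dvd_pow p (k + 2).le_succ)) hle with hπac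
  have e4 : ∑ τ ∈ Finset.univ.filter (fun τ => acProj K p (k + 2) (picRes K (pow_dvd_pow p (k + 2).le_succ) τ) =
        acProj K p (k + 2) ρ), ((T.y p φ (k + 3) τ : ℤ) : ℤ_[p]) =
      ∑ τ ∈ Finset.univ.filter (fun τ => πac (acProj K p (k + 3) τ) = (acProj K p (k + 2) ρ)⁻¹),
        (T.lTilde p φ (k + 3)).coeff τ := by
    refine Finset.sum_nbij' (fun τ => τ⁻¹) (fun τ => τ⁻¹) (fun τ hτ => ?_) (fun τ hτ => ?_)
      (fun τ _ => inv_inv τ) (fun τ _ => inv_inv τ) (fun τ _ => ?_)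
    · simp only [Finset.mem_filter, Finset.mem_univ, true_and] at hτ ⊢
      rw [map_inv, map_inv, ← hmap, hτ]
    · simp only [Finset.mem_filter, Finset.mem_univ, true_and] at hτ ⊢
      rw [map_inv, map_inv, hmap, hτ, inv_inv]
    · rw [GrossPointTower.coeff_lTilde, inv_inv]
  rw [e4]
  exact dvd_sum_filter_comp_coeff p (acProj K p (k + 3)) (T.lTilde p φ (k + 3)) d h
    (fun q' => πac q' = (acProj K p (k + 2) ρ)⁻¹)

/-- **`p ∣ L_{k+2} ⇒ p ∣ L_k`** (all coefficients; `K` imaginary quadratic, `p` odd, `p ∤ N⁺N⁻`, `T(p)φ = aφ` with `p ∣ a` —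
at a supersingular prime `a = 0`): the `q`-coefficient of `L_k` is `Σ_{δ'} y_{k+1}(ρ₀δ')` with `[ρ₀] = q⁻¹`
(`coeff_lAc_eq_sum_torsionImage`); by (8) (`sum_fibre_y_eq`, `ρ` a lift of `ρ₀`) it equals `a·(…)` minus a `Δ`-fibre-union
sum of `y_{k+3}`, divisible by `p` by `dvd_sum_fibre_y_of_dvd_coeff_lAc`. [cite: DarmonIovita2008, §2.2 (8)]
[cite: PollackWeston2011, §2.4, proof of Thm. 2.5] -/
theorem dvd_coeff_lAc_of_dvd_coeff_lAc_add_two [Fintype (Brandt.ClassSet S.O)] (hK : IsImaginaryQuadratic K)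
    (hp2 : p ≠ 2) (hpN : ¬ p ∣ Nplus * Nminus) (φ : Brandt.ClassSet S.O → ℤ) (a : ℤ)
    (hφ : Brandt.matrix S.O p *ᵥ φ = a • φ) (hpa : (p : ℤ) ∣ a) (T : GrossPointTower K S p) (k : ℕ)
    (h : ∀ q, (p : ℤ_[p]) ∣ (T.lAc p φ (k + 2)).coeff q) :
    ∀ q, (p : ℤ_[p]) ∣ (T.lAc p φ k).coeff q := by
  classical
  haveI := @Fintype.ofFinite (ClassGroup (quadOrder K (p ^ (k + 3)))) (finite_classGroup (K := K) _)
  haveI := @Fintype.ofFinite (ClassGroup (quadOrder K (p ^ (k + 2)))) (finite_classGroup (K := K) _)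
  haveI := @Fintype.ofFinite (ClassGroup (quadOrder K (p ^ (k + 1)))) (finite_classGroup (K := K) _)
  intro q
  -- lifts: `[ρ₀] = q⁻¹` in `G̃_{k+1}/Δ`, `ρ̄ = ρ₀`
  obtain ⟨ρ₀, hρ₀⟩ := QuotientGroup.mk'_surjective (torsionImage K p (k + 1)) q⁻¹
  have hd : p ^ (k + 2) = p ^ (k + 1) * p := pow_succ p (k + 1)
  obtain ⟨ρ, hρ⟩ := picRes_surjective (K := K) hK.1 (dvd_pow_self p k.succ_ne_zero) hd ρ₀
  have hρ' : picRes K (pow_dvd_pow p (k + 1).le_succ) ρ = ρ₀ := hρ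
  rw [coeff_lAc_eq_sum_torsionImage p φ T k q ρ₀ hρ₀]
  -- Darmon–Iovita (8) at `ρ`, cast into `ℤ_p`
  have rel := sum_fibre_y_eq p hK hp2 hpN φ a hφ T k ρ
  rw [hρ'] at rel
  have rel' := congrArg (fun z : ℤ => (z : ℤ_[p])) rel
  push_cast at rel'
  have e3 : ∑ δ' ∈ Finset.univ.filter (· ∈ torsionImage K p (k + 1)), ((T.y p φ (k + 1) (ρ₀ * δ') : ℤ) : ℤ_[p]) =
      (a : ℤ_[p]) * ∑ δ ∈ Finset.univ.filter (· ∈ torsionImage K p (k + 2)), ((T.y p φ (k + 2) (ρ * δ) : ℤ) : ℤ_[p]) -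
        ∑ τ ∈ Finset.univ.filter (fun τ => acProj K p (k + 2) (picRes K (pow_dvd_pow p (k + 2).le_succ) τ) =
          acProj K p (k + 2) ρ), ((T.y p φ (k + 3) τ : ℤ) : ℤ_[p]) := by
    linear_combination rel'
  rw [e3]
  refine dvd_sub (Dvd.dvd.mul_right ?_ _) (dvd_sum_fibre_y_of_dvd_coeff_lAc p φ T k ρ _ h)
  obtain ⟨c, hc⟩ := hpa
  exact ⟨(c : ℤ_[p]), by rw [hc]; push_cast; ring⟩

/-- **`μ(L_k) = 0 ⇒ μ(L_{k+2}) = 0`**: a unit coefficient of `L_k` forces one of `L_{k+2}` (`p ∣ a`; hypotheses as above).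
[cite: DarmonIovita2008, §2.2 (8)] [cite: PollackWeston2011, §2.4, proof of Thm. 2.5] -/
theorem exists_isUnit_coeff_lAc_add_two [Fintype (Brandt.ClassSet S.O)] (hK : IsImaginaryQuadratic K)
    (hp2 : p ≠ 2) (hpN : ¬ p ∣ Nplus * Nminus) (φ : Brandt.ClassSet S.O → ℤ) (a : ℤ)
    (hφ : Brandt.matrix S.O p *ᵥ φ = a • φ) (hpa : (p : ℤ) ∣ a) (T : GrossPointTower K S p) (k : ℕ)
    (h : ∃ q, IsUnit ((T.lAc p φ k).coeff q)) : ∃ q, IsUnit ((T.lAc p φ (k + 2)).coeff q) := by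
  by_contra hcon
  push Not at hcon
  obtain ⟨q, hq⟩ := h
  have hall : ∀ q', (p : ℤ_[p]) ∣ (T.lAc p φ (k + 2)).coeff q' := fun q' => by
    have := hcon q'
    rwa [isUnit_iff_not_dvd, not_not] at this
  exact (isUnit_iff_not_dvd p _).mp hq (dvd_coeff_lAc_of_dvd_coeff_lAc_add_two p hK hp2 hpN φ a hφ hpa T k hall q)

/-- **`μ(L_k) = 0 ⇒ μ(L_{k+2j}) = 0` for every `j`** (propagation within a parity class). [cite: DarmonIovita2008, §2.2 (8)]
[cite: PollackWeston2011, §2.4, proof of Thm. 2.5] -/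
theorem exists_isUnit_coeff_lAc_add_two_mul [Fintype (Brandt.ClassSet S.O)] (hK : IsImaginaryQuadratic K)
    (hp2 : p ≠ 2) (hpN : ¬ p ∣ Nplus * Nminus) (φ : Brandt.ClassSet S.O → ℤ) (a : ℤ)
    (hφ : Brandt.matrix S.O p *ᵥ φ = a • φ) (hpa : (p : ℤ) ∣ a) (T : GrossPointTower K S p) (k : ℕ)
    (h : ∃ q, IsUnit ((T.lAc p φ k).coeff q)) (j : ℕ) : ∃ q, IsUnit ((T.lAc p φ (k + 2 * j)).coeff q) := by
  induction j with
  | zero => simpa using h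
  | succ j ih =>
    have e : k + 2 * (j + 1) = (k + 2 * j) + 2 := by ring
    rw [e]
    exact exists_isUnit_coeff_lAc_add_two p hK hp2 hpN φ a hφ hpa T (k + 2 * j) ih

/-! ### §5 `μ(L_n) = 0` for all large `n` ⟺ one even and one odd witness -/

/-- **Pollack–Weston's "`μ(L_n) = 0` for `n` large enough" ⟺ ONE EVEN AND ONE ODD WITNESS** (`K` imaginary quadratic, `p` odd,
`p ∤ N⁺N⁻`, `T(p)φ = aφ` with `p ∣ a`): `HasMuZeroLAc ↔ (∃ n even, ∃ q, L_n(q) ∈ ℤ_pˣ) ∧ (∃ n odd, ∃ q, L_n(q) ∈ ℤ_pˣ)`. The two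
parities are the two signs `λ_f^±` (DI Prop. 2.8 / PW: "For a fixed parity of `n` … yields `λ_f^ε`"); within a parity class a
witness propagates upward by §4, and `HasMuZeroLAc` trivially supplies witnesses of both parities.
[cite: PollackWeston2011, §2.4 Thm. 2.5 (i) and its proof] [cite: DarmonIovita2008, §2.2 (8), Prop. 2.8] -/
theorem hasMuZeroLAc_iff_even_odd [Fintype (Brandt.ClassSet S.O)] (hK : IsImaginaryQuadratic K)
    (hp2 : p ≠ 2) (hpN : ¬ p ∣ Nplus * Nminus) (φ : Brandt.ClassSet S.O → ℤ) (a : ℤ)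
    (hφ : Brandt.matrix S.O p *ᵥ φ = a • φ) (hpa : (p : ℤ) ∣ a) (T : GrossPointTower K S p) :
    T.HasMuZeroLAc p φ ↔
      (∃ n, Even n ∧ ∃ q, IsUnit ((T.lAc p φ n).coeff q)) ∧ (∃ n, Odd n ∧ ∃ q, IsUnit ((T.lAc p φ n).coeff q)) := by
  constructor
  · rintro ⟨n₀, h⟩
    exact ⟨⟨2 * n₀, even_two_mul _, h _ (by omega)⟩, ⟨2 * n₀ + 1, odd_two_mul_add_one _, h _ (by omega)⟩⟩
  · rintro ⟨⟨ne, hne, he⟩, ⟨no, hno, ho⟩⟩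
    refine ⟨ne + no, fun n hn => ?_⟩
    rcases Nat.even_or_odd n with hn2 | hn2
    · obtain ⟨j, hj⟩ : ∃ j, n = ne + 2 * j := by
        obtain ⟨r, hr⟩ := hne
        obtain ⟨s, hs⟩ := hn2
        exact ⟨s - r, by omega⟩
      rw [hj]
      exact exists_isUnit_coeff_lAc_add_two_mul p hK hp2 hpN φ a hφ hpa T ne he j
    · obtain ⟨j, hj⟩ : ∃ j, n = no + 2 * j := by
        obtain ⟨r, hr⟩ := hno
        obtain ⟨s, hs⟩ := hn2
        exact ⟨s - r, by omega⟩
      rw [hj]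
      exact exists_isUnit_coeff_lAc_add_two_mul p hK hp2 hpN φ a hφ hpa T no ho j

/-- **The two bottom layers suffice**: unit coefficients of `L_0 ∈ ℤ_p[Pic(𝒪_p)/Δ]` and `L_1 ∈ ℤ_p[Pic(𝒪_{p²})/Δ]` give
`μ(L_n) = 0` for ALL `n` — a per-tower finite certificate for PW Thm. 2.5 (i)'s conclusion (finitely many Gross points of
conductor `p` and `p²`). [cite: PollackWeston2011, §2.4 Thm. 2.5 (i)] [cite: DarmonIovita2008, §2.2 (8)] -/
theorem hasMuZeroLAc_of_isUnit_coeff_zero_one [Fintype (Brandt.ClassSet S.O)] (hK : IsImaginaryQuadratic K)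
    (hp2 : p ≠ 2) (hpN : ¬ p ∣ Nplus * Nminus) (φ : Brandt.ClassSet S.O → ℤ) (a : ℤ)
    (hφ : Brandt.matrix S.O p *ᵥ φ = a • φ) (hpa : (p : ℤ) ∣ a) (T : GrossPointTower K S p)
    (h0 : ∃ q, IsUnit ((T.lAc p φ 0).coeff q)) (h1 : ∃ q, IsUnit ((T.lAc p φ 1).coeff q)) :
    T.HasMuZeroLAc p φ :=
  (hasMuZeroLAc_iff_even_odd p hK hp2 hpN φ a hφ hpa T).mpr ⟨⟨0, ⟨0, rfl⟩, h0⟩, ⟨1, ⟨0, rfl⟩, h1⟩⟩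

/-- **PW Thm. 2.5 (i) for ONE tower from its first two layers, in the hypothesis shape of the named fact
`pollackWeston2011_thm_2_5_hasMuZeroLAc`** (`a_p(E) = 0`, `p ∤ N⁺N⁻`, `φ` a generator of the `a(E)`-eigen-line, `K` imaginary
quadratic, `p` odd; the fact's other hypotheses — square-free level, splitting of `N⁺`/`N⁻`, irreducibility, PW's normalisation —
are not needed for this implication): two unit coefficients, of `L_0` and of `L_1`, give `T.HasMuZeroLAc p φ`. The CLASS-WIDE fact
(all `K`, all towers: Vatsal 2003 / PW "generalize immediately") is untouched; per instance its conclusion is this finite check.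
[cite: PollackWeston2011, §2.4 Thm. 2.5 (i)] [cite: DarmonIovita2008, §2.2 (8)] -/
theorem hasMuZeroLAc_of_first_two_layers (W : WeierstrassCurve ℚ) [W.IsElliptic] [Fintype (Brandt.ClassSet S.O)]
    (hK : IsImaginaryQuadratic K) (hp2 : p ≠ 2) (hpN : ¬ p ∣ Nplus * Nminus) (hap : W.LFunction p = 0)
    (φ : Brandt.ClassSet S.O → ℤ)
    (hφ : Brandt.eigenLattice (Nplus * Nminus) (Brandt.matrix S.O) (fun n => W.LFunction n) = ℤ ∙ φ)
    (T : GrossPointTower K S p)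
    (h0 : ∃ q, IsUnit ((T.lAc p φ 0).coeff q)) (h1 : ∃ q, IsUnit ((T.lAc p φ 1).coeff q)) :
    T.HasMuZeroLAc p φ := by
  have hmem : φ ∈ Brandt.eigenLattice (Nplus * Nminus) (Brandt.matrix S.O) (fun n => W.LFunction n) := by
    rw [hφ]; exact Submodule.mem_span_singleton_self φ
  have heig : Brandt.matrix S.O p *ᵥ φ = (0 : ℤ) • φ := by
    rw [(Brandt.mem_eigenLattice_iff.mp hmem) p hp.out hpN, hap]
  exact hasMuZeroLAc_of_isUnit_coeff_zero_one p hK hp2 hpN φ 0 heig (dvd_zero _) T h0 h1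

end Summit.BirchSwinnertonDyer.BirchSwinnertonDyer.Theorems.DefmuSupersingularTheta

end
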